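import Mathlib
import HarnessLib
import HarnessLib.Audit
import Summits.AtomisticToContinuum.Statement
import Literature.MathematicalPhysics.QuantumLattice.XYOrder
import Literature.MathematicalPhysics.QuantumManyBody.PeriodicBoseGas

/-!
Route: BECZeroCrossingAnchor

CLOSED (retired) 2026-08-15T13:41:06Z by operator:999:1257524 — reason: not-a-thesis: assembly does not conclude the sub-problem Statement — note: D-0027 §2.1 audit (human 2026-08-15: routes that do not decide the summit are removed): the assembly concludes `Literature.MathematicalPhysics.QuantumManyBody.BoseGas.BoseEinsteinCondensation`, not the sub-problem statement; a NEW conforming route may be opened from the same idea (generated `closes . The file is kept as the record of this route; refuted decls are indexed as negative knowledge (`ledger negatives`).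

# Route BECZeroCrossingAnchor — zero-crossing anchor — easy-plane XXZ ferromagnet = hard-core
lattice gas with a(Δ)→0 at the exactly condensed SU(2) point; KLS end moved by sector monotonicity,
SU(2) end by bounded deformation

ONE family with two theorem ends (card xxz-zero-crossing-anchor, spine and sole card): the spin-½
easy-plane XXZ FERROMAGNET
H_Δ = −Σ_⟨xy⟩(S¹_xS¹_y + S²_xS²_y + Δ S³_xS³_y) = `xxzHamiltonian 1 (torusGraph d L) (−1) Δ` on the
torus (ℤ/Lℤ)^d, 0 ≤ Δ ≤ 1, which by
Matsubara–Matsuda is the hard-core lattice Bose gas (hopping ½) with nearest-neighbour ATTRACTION Δ;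
the sector of N bosons (S³_tot = N − L^d/2)
is encoded exactly as in route BECFillingMonotone by the penalised Hamiltonian H_Δ +
(d+1)L^d·(S³_tot + (L^d/2 − N)·1)² (penalty > spectral width
d·L^d of H_Δ for |Δ| ≤ 1), A_L(N,Δ) = Re ω(S¹_tot² + S²_tot²) is the planar moment of its (tracial =
unique, Perron–Frobenius) ground state and
B_L(N,Δ) = A + N − L^d/2 = ⟨S⁺_tot S⁻_tot⟩ = Σ_x,y γ_N(x,y) = L^d·λ_max(γ_N). End Δ = 0 is KLS (tree
theorem `kennedy_lieb_shastry_xy_ground_holds`);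
end Δ = 1 is the SU(2) point, where EVERY sector ground state is the hard-core-projected condensate
|S = L^d/2, M⟩, B_L(N,1) = N(L^d − N + 1) EXACTLY
(Tóth's upper bound saturated) and the two-magnon scattering length a(Δ) ∝ (1 − Δ) crosses zero
(Dyson's kinematical cancellation).
It suffices to show X = X_IR ∧ X_tr ∧ X_bc: X_IR (NearIsotropicPersistence, card G3) — for d ≥ 3
there is ε > 0 with 2·B_L(N,Δ) ≥ N(L^d − N + 1)
for ALL L, N and Δ ∈ [1 − ε, 1] (condensation persists under the bounded anisotropy deformation,
uniformly in volume and filling); X_tr (MethodTransfer,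
card G5) — X_IR at d = 3 ⇒ PeriodicBEC (route BECPeriodicReduction's rank-2 item, verbatim as
consequent); X_bc = BoundaryTransferWeak (stmt-0827,
shared). The route's rank-2 crux is the card's comparison line G2 in the repaired, summed form:
AnisotropyMonotone — in every sector Δ ↦ A_L(N,Δ) is
non-decreasing on [0,1]; with the provable SectorMixtureBound and KLS it yields the lattice Target
EasyPlaneIntervalLRO (planar LRO = BEC of hard-core
bosons with nn attraction for EVERY Δ ∈ [0,1], d ≥ 2, in a sector of filling between c and ½), which
X_IR yields independently near Δ = 1.
Lean: `(∀ d : ℕ, 3 ≤ d → ∃ ε : ℝ, 0 < ε ∧ ∀ (L : ℕ) [NeZero L], 2 ≤ L → ∀ N : ℕ, N ≤ L ^ d → ∀ Δ :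
ℝ, 1 - ε ≤ Δ → Δ ≤ 1 → (N : ℝ) * ((L : ℝ) ^ d - N + 1) ≤ 2 *
(((Literature.MathematicalPhysics.QuantumLattice.xxzHamiltonian 1
(Literature.Probability.LatticeModels.torusGraph d L) (-1) Δ + (((d + 1) * L ^ d : ℕ) : ℂ) •
(Literature.MathematicalPhysics.QuantumLattice.totalSpin 1 2 + ((L : ℂ) ^ d / 2 - (N : ℂ)) • 1) ^
2).groundStateFunctional (Literature.MathematicalPhysics.QuantumLattice.totalSpin 1 0 *
Literature.MathematicalPhysics.QuantumLattice.totalSpin 1 0 +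
Literature.MathematicalPhysics.QuantumLattice.totalSpin 1 1 *
Literature.MathematicalPhysics.QuantumLattice.totalSpin 1 1)).re + N - (L : ℝ) ^ d / 2)) ∧ ((∃ ε :
ℝ, 0 < ε ∧ ∀ (L : ℕ) [NeZero L], 2 ≤ L → ∀ N : ℕ, N ≤ L ^ 3 → ∀ Δ : ℝ, 1 - ε ≤ Δ → Δ ≤ 1 → (N : ℝ) *
((L : ℝ) ^ 3 - N + 1) ≤ 2 * (((Literature.MathematicalPhysics.QuantumLattice.xxzHamiltonian 1
(Literature.Probability.LatticeModels.torusGraph 3 L) (-1) Δ + (((3 + 1) * L ^ 3 : ℕ) : ℂ) •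
(Literature.MathematicalPhysics.QuantumLattice.totalSpin 1 2 + ((L : ℂ) ^ 3 / 2 - (N : ℂ)) • 1) ^
2).groundStateFunctional (Literature.MathematicalPhysics.QuantumLattice.totalSpin 1 0 *
Literature.MathematicalPhysics.QuantumLattice.totalSpin 1 0 +
Literature.MathematicalPhysics.QuantumLattice.totalSpin 1 1 *
Literature.MathematicalPhysics.QuantumLattice.totalSpin 1 1)).re + N - (L : ℝ) ^ 3 / 2)) → ∀ v : ℝ →
ENNReal, Literature.MathematicalPhysics.QuantumManyBody.BoseGas.IsRepulsiveFiniteRange v → ∃ ρ₀ : ℝ,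
0 < ρ₀ ∧ ∀ ρ : ℝ, 0 < ρ → ρ < ρ₀ → ∃ c : ℝ, 0 < c ∧ ∀ᶠ N : ℕ in Filter.atTop, ∃ δ : ENNReal, 0 < δ ∧
∀ Ψ : Literature.MathematicalPhysics.QuantumManyBody.BoseGas.PeriodicTrialState N
(Literature.MathematicalPhysics.QuantumManyBody.BoseGas.sideLength ρ N),
Literature.MathematicalPhysics.QuantumManyBody.BoseGas.periodicEnergy v Ψ ≤
Literature.MathematicalPhysics.QuantumManyBody.BoseGas.periodicGroundStateEnergy v N
(Literature.MathematicalPhysics.QuantumManyBody.BoseGas.sideLength ρ N) + δ → ENNReal.ofReal (c * N)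
≤ Literature.MathematicalPhysics.QuantumManyBody.BoseGas.condensateOccupation N
(Literature.MathematicalPhysics.QuantumManyBody.BoseGas.sideLength ρ N) Ψ.ψ) ∧ (∀ v : ℝ → ENNReal,
Literature.MathematicalPhysics.QuantumManyBody.BoseGas.IsRepulsiveFiniteRange v → (∃ ρ₀ : ℝ, 0 < ρ₀
∧ ∀ ρ : ℝ, 0 < ρ → ρ < ρ₀ → ∃ c : ℝ, 0 < c ∧ ∀ᶠ N : ℕ in Filter.atTop, ∃ δ : ENNReal, 0 < δ ∧ ∀ Ψ :
Literature.MathematicalPhysics.QuantumManyBody.BoseGas.PeriodicTrialState N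
(Literature.MathematicalPhysics.QuantumManyBody.BoseGas.sideLength ρ N),
Literature.MathematicalPhysics.QuantumManyBody.BoseGas.periodicEnergy v Ψ ≤
Literature.MathematicalPhysics.QuantumManyBody.BoseGas.periodicGroundStateEnergy v N
(Literature.MathematicalPhysics.QuantumManyBody.BoseGas.sideLength ρ N) + δ → ENNReal.ofReal (c * N)
≤ Literature.MathematicalPhysics.QuantumManyBody.BoseGas.condensateOccupation N
(Literature.MathematicalPhysics.QuantumManyBody.BoseGas.sideLength ρ N) Ψ.ψ) → ∃ ρ₀ : ℝ, 0 < ρ₀ ∧ ∀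
ρ : ℝ, 0 < ρ → ρ < ρ₀ → Literature.MathematicalPhysics.QuantumManyBody.BoseGas.HasGroundStateBEC v
ρ)`

## Assembly
Pure logic (checked sorry-free in Sketch.lean): specialise NearIsotropicPersistence to d = 3, feed
MethodTransfer to get PeriodicBEC, and
`fun v hv => BoundaryTransferWeak v hv (PeriodicBEC v hv)` is the conjunct. AnisotropyMonotone is
deliberately NOT an antecedent: it feeds the
lattice Target (with SectorMixtureBound and the tree's KLS theorem; glue filed when it closes) and
is the cheapest decisive test of the dictionary,
but the implication to the conjunct does not need it, so its refutation forces a restate/drop, never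
a broken assembly.

Rationale: WHY THIS LINE. The planar S = ½ ferromagnet on (0,1) sits between the only two kinds of rigorously
condensed interacting Bose gases on ℤ^d — the reflection-positive
family at Δ ≤ 0 (KLS1988PRL at Δ = 0; KuboKishi1988 / BjornbergUeltschi2022 for nn repulsion;
LSSY2005 Ch. 11) and the Heisenberg point Δ = 1, where
condensation of the hard-core gas is EXACT in every canonical sector by SU(2) (Heims1964; Tasaki2020
§2.5; the value N(L^d−N+1) is Toth1991's bound) —
and reflection positivity provably cannot enter the interval (ferromagnetic z-coupling has the wrong
sign parity: Speer1985).
The dictionary is quantitative (MatsubaraMatsuda1956, Dyson1956): ρa³ ↦ Y = ν(c₃(1−Δ))³ → 0 at FIXED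
filling, magnon dispersion = Bogoliubov's,
healing length (1−Δ)^(−1/2), and the deformation V = Σ S³S³ is BOUNDED (relative size 1−Δ) with an
explicit unperturbed eigenbasis — so the marginal
d = 3, T = 0 infrared problem (Benfatto1994; BalabanEtAl2010, whose stated goal is symmetry breaking
for lattice bosons; CorreggiGiulianiSeiringer2015
for the free energy near the ferromagnetic point) appears here without any ultraviolet, hard-core or
large-field complication: NearIsotropicPersistence
is that problem's least encumbered instance, and AnisotropyMonotone is a canonical (fixed-sector)
Griffiths/Ginibre-type comparison between positive
ground states of one stoquastic family, where the sector restriction removes the direction mixing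
that gives the zero-field inequalities of
BenassiLeesUeltschi2016 the opposite tendency. Imported: correlation-inequality / Perron–Frobenius
order methods (statistical mechanics), constructive
RG around an exactly solvable gapless point (the continuum twin of the SU(2) point — Neumann-contact
hard spheres, whose ground state is the constant
on the excluded-volume domain, scattering length 0, i.e. Penrose–Onsager's 1956 trial function — is
route BECParentHamiltonian's Jastrow anchor with the
step profile, which is why the transfer crux is stated towards PeriodicBEC and not as a new
continuum model). Prior routes are continuum-internal except
BECFillingMonotone (dial = filling at Δ = 0); this route's dial is the anisotropy at fixed sector,
and its negatives-index footprint is empty.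

RANKED CRUXES. #0 EasyPlaneIntervalLRO (target) — the lattice headline (card G4 widened to the whole
interval and all d ≥ 2): for every d ≥ 2 there are c > 0 and L₀ such that for every even L ≥ L₀ and
EVERY Δ ∈ [0,1] some sector N ≤ L^d/2 of the XXZ_Δ ferromagnet on (ℤ/Lℤ)^d has ⟨S⁺_tot S⁻_tot⟩ =
A_L(N,Δ) + N − L^d/2 ≥ c·L^(2d) (planar long-range order = BEC of the hard-core gas with nn
attraction Δ; by B ≤ N(L^d−N+1) the sector has filling ≥ c). Reached from AnisotropyMonotone +
SectorMixtureBound + KLS (glue, later) and, for Δ ∈ [1−ε,1], from NearIsotropicPersistence. (why it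
might fail: as far as searched it is OPEN for every Δ ∈ (0,1) (no RP: Speer parity); false only if
nn attraction below the Heisenberg point destroys the XY condensate at every non-trivial filling on
large tori — no mechanism known (spin-wave theory, a(Δ) > 0).) [KLS1988PRL, KuboKishi1988,
Speer1985, LSSY2005 Ch. 11 §11.1, BjornbergUeltschi2022, ZvyaginTsukernik1985]
#2 AnisotropyMonotone (crux) — (card G2, REPAIRED per audit-12 to the summed moment) for all d ≥ 1,
L ≥ 2, every sector N ≤ L^d and 0 ≤ Δ ≤ Δ' ≤ 1: A_L(N,Δ) ≤ A_L(N,Δ') — raising the ferromagnetic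
z-coupling (lowering the magnon scattering length) never lowers the planar moment of the sector
ground state; at Δ' = 1 it is automatic (A_L(N,1) is the maximum of S¹_tot²+S²_tot² on the sector)
and dA/dΔ = 0 there. [difficulty: L] (why it might fail: no sector-restricted Griffiths/Ginibre
inequality exists and the zero-field thermal tendency is opposite (BenassiLeesUeltschi2016); the
pointwise nn form is false (audit-12); ONE small torus (any d, L, N) with A decreasing somewhere on
[0,1] kills it — ED not yet run (compute socket down at filing).) [BenassiLeesUeltschi2016,
KLS1988PRL, Toth1991, Tasaki2020 §2.5, LSSY2005 Ch. 11 §11.1]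
#3 NearIsotropicPersistence (crux) — (card G3) for every d ≥ 3 there is ε > 0 such that for all L ≥
2, all N ≤ L^d and all Δ ∈ [1−ε, 1]: 2·B_L(N,Δ) ≥ N(L^d − N + 1) — at least half of the exact SU(2)
value N(L^d−N+1) = B_L(N,1) survives the bounded easy-plane deformation (1−Δ)·Σ S³S³, UNIFORMLY in
volume and filling (small parameter Y = ν(c₃(1−Δ))³). [difficulty: open-problem] (why it might fail:
it IS the marginal d = 3, T = 0 infrared problem (BogoliubovPerturbationInfrared): second order in
(1−Δ) gives Σ_k k⁻⁴ ∼ L; no ordered continuous-symmetry Bose phase has ever been constructed (BFKT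
incomplete, n! bounds in Benfatto's scheme); uniformity in N near ν = ½ is the hardest corner.)
[Benfatto1994, BalabanEtAl2010, CorreggiGiulianiSeiringer2015, Dyson1956, Heims1964,
Literature.Barriers.AtomisticToContinuum.BogoliubovPerturbationInfrared]
#4 MethodTransfer (crux) — (card G5, the continuum re-run) NearIsotropicPersistence at d = 3 implies
PeriodicBEC: for every repulsive finite-range radial v, small ρ and all large N, every
δ-near-minimiser of the periodic N-body energy on the torus of side (N/ρ)^(1/3) has constant-mode
occupation ≥ cN (route BECPeriodicReduction's rank-2 item stmt-0826, verbatim as consequent).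
Intended mechanism: the scheme proving the antecedent (bounded deformation of an exactly condensed
gapless point, small parameter Y) re-run with Y = ρa³ after a Dyson-lemma softening of v; only the
scheme transfers, not the anchor. [deps: NearIsotropicPersistence] [difficulty: open-problem] (why
it might fail: bare implication, no easier than PeriodicBEC unless the antecedent is proved by a
transferable scheme: the continuum has no symmetry-protected a = 0 point at fixed admissible v (its
twin, Neumann-contact hard spheres, is a boundary condition), and hard cores v = ⊤ make the
deformation unbounded.) [LSSY2005 Ch. 5 (5.2), Fournais2020, MatsubaraMatsuda1956, Benfatto1994,
Literature.Barriers.AtomisticToContinuum.BogoliubovPerturbationInfrared]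
#5 BoundaryTransferWeak (crux) — (shared item stmt-AtomisticToContinuum-0827 of route
BECPeriodicReduction, verbatim) for each repulsive finite-range v, PeriodicBEC(v) implies ∃ρ₀ > 0 ∀ρ
∈ (0, ρ₀), HasGroundStateBEC v ρ (Dirichlet ground state, λ_max(γ) ≥ cN via condensateNumber).
[deps: MethodTransfer] [difficulty: L] (why it might fail: PeriodicBEC(v) is ground-state-only at
the box (N/ρ)^(1/3): the Dirichlet ground state is a periodic trial state but lies a wall term ≫ δ
above E₀^per, and interior restrictions are neither periodic nor of sharp N; BEC is
boundary-condition sensitive (Robinson1976).) [LSSY2005 Ch. 2 after (2.8), Robinson1976,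
LauwersVerbeureZagrebnov2003, Junge2026, BoccatoSeiringer2023]
#9 SectorMixtureBound (support) — (shared item stmt-AtomisticToContinuum-5009 of route
BECFillingMonotone, verbatim; the Δ = 0 end of the glue) for d ≥ 1 and even L, the all-sector
(tracial) KLS planar moment Σ_x,y groundStateXYCorrTorus L 1 x y is at most A_L(N,0) for some sector
with 2N ≤ L^d (block decomposition of the ground projector in S³_tot + spin flip); note
`xxzHamiltonian 1 (torusGraph d L) (−1) 0 = xyTorus d L 1` is `rfl` (Sketch.lean). [difficulty:
provable-now] [KLS1988PRL, Tasaki2020 §2.1–2.2]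
#9 AnchorExact (support) — (card G1(i), the SU(2) end) for d ≥ 1, L ≥ 2 and every N ≤ L^d: A_L(N,1)
+ N − L^d/2 = N(L^d − N + 1) — at Δ = 1, H_1 + (number of edges)/4 = ½Σ_⟨xy⟩(1 − T_xy) (T =
transposition), so on the connected torus the sector ground space is the one symmetric vector |S =
L^d/2, M = N − L^d/2⟩ (penalty selects the sector), and ⟨S⁺_tot S⁻_tot⟩ = S(S+1) − M² + M.
[difficulty: provable-now] [Tasaki2020 §2.5, Toth1991, Heims1964]
#9 PenaltySelectsSectorXXZ (support) — (encoding lemma, XXZ version of BECFillingMonotone's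
PenaltySelectsSector) for d ≥ 1, N ≤ L^d and 0 ≤ Δ ≤ 1, every ground vector of H_Δ +
(d+1)L^d·(S³_tot + (L^d/2 − N)·1)² lies in the sector S³_tot = N − L^d/2: each bond −(S¹S¹ + S²S² +
ΔS³S³) has spectral width exactly 1 for |Δ| ≤ 1, so the width of H_Δ is ≤ (number of edges) ≤ d·L^d
< (d+1)L^d, and the sector is non-empty. [difficulty: provable-now] [Tasaki2020 §2.1, KLS1988PRL]
#9 ScatteringLengthSign (support) — (card G1(ii), the sign the dictionary rests on; d = 3) for every
Δ ∈ [0,1) the two-magnon finite-volume energy shift is eventually positive at the scattering-length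
scale: liminf_L L³·(E_L(2) − 2E_L(1) + E_L(0)) > 0, E_L(k) = lowest energy of H_Δ on (ℤ/Lℤ)³ in the
sector S³_tot = k − L³/2 (Huang–Yang/Lüscher: the limit is 8π·a(Δ) with a(Δ) > 0 the s-wave
scattering length of hard core + nn attraction Δ, decreasing to a(1) = 0; at Δ = 1 the shift
vanishes identically by SU(2)). [difficulty: M] [Dyson1956, doi:10.1103/PhysRev.132.85, LSSY2005
App. A, Tasaki2020 §2.5]

TWO-LAYER PLAN. Foreseen glued splits (none filed now; k ≤ 3, depth 1): EasyPlaneIntervalLRO ⇐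
AnisotropyMonotone → SectorMixtureBound → Target (glue ≈ unfolding
HasEvenTorusLRO of `kennedy_lieb_shastry_xy_ground_holds d _ 1 _` on even tori, B ≥ A − L^d/2);
AnisotropyMonotone ⇐ MonotoneStep (dA/dΔ ≥ 0 as a
ground-state linear-response sign: 2 Re ω₀(𝒜·R₀·Σ_⟨xy⟩S³_xS³_y) ≥ 0, R₀ = reduced resolvent ≥ 0 of
the sector, Σ S³S³ diagonal and 𝒜 = S⁺_totS⁻_tot
entrywise non-negative in the Perron–Frobenius basis) → AnalyticInDelta (sector ground state unique
for all Δ, so A is real-analytic) → AnisotropyMonotone; NearIsotropicPersistence ⇐ LowFilling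
(N ≤ ν₀L^d, the dilute corner, where ladder resummation suffices) → SectorGapPersistence (uniform
(1−Δ)-independent lower bound on the sector
Goldstone structure) → NearIsotropicPersistence; MethodTransfer ⇐ DysonSoftening →
BoundedDeformationScheme → MethodTransfer (only once C3 has a proof).
Helper lemmas (spectral width of a bond, block decomposition, spin flip, S⁺S⁻ = S² − (S³)² + S³)
ride as `--supports`, never items.

KILL CRITERIA. A certified violation of AnisotropyMonotone (sector ED on any torus — d = 1 rings L ≤
12, 4×4, 2×2×2, 4×4×4 at N ≤ 3 — or sign-free SSE/worm QMC
at two consecutive sizes) refutes the rank-2 crux: repair by `--restate` to the thermodynamic-limit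
form (liminf_L L^(−2d)(A_L(N_L,Δ') − A_L(N_L,Δ)) ≥ 0)
if the violation is a finite-size wiggle, else `--drop` (the Assembly does not use it) and the
card's comparison line is dead — the route continues on
X_IR. A proof that a(Δ) < 0 somewhere on [0,1) (¬ScatteringLengthSign) kills the whole dictionary:
close `refuted:ScatteringLengthSign`.
NearIsotropicPersistence refuted (some d ≥ 3 where condensation fails for Δ arbitrarily close to 1
on large tori) closes the route
`refuted:NearIsotropicPersistence`. PeriodicBEC or the conjunct proved elsewhere moots
MethodTransfer/BoundaryTransferWeak but not the lattice items;
EasyPlaneIntervalLRO proved by any method closes rank 0 and demotes AnisotropyMonotone to support.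

NOT DECOMPOSED YET. The constants (ε(d), c(d), c₃ = −a′(1), L₀); the glue Target ⇐ C2 +
SectorMixtureBound + KLS (a provable ≈ 200-line item, filed when C2 closes);
the M = 0 (half-filling) pinning of the Target, which needs BECFillingMonotone's
HalfFillingMaximisesMoment or a 'global ground state meets S³_tot = 0'
lemma (shared later, not duplicated); the thermodynamic-limit and long-distance variants of
AnisotropyMonotone (kept in reserve as restates); the
explicit second-order spin-wave value of A near both ends (Numbers); every layer-2 child of
MethodTransfer (Dyson softening, the continuum bounded-
deformation scheme), which waits for a proof of C3; positive temperature (d ≥ 3, a different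
thesis); spins S ≥ 1 (occupancy ≤ 2S bosons), where the
classical out-of-plane tendency competes and monotonicity is NOT claimed.

CHEAPEST FALSIFIER. Sector-resolved Lanczos ED of H_Δ on Δ ∈ {0, 0.1, …, 1}: all sectors of the
rings L = 4…12 (d = 1), of 2×2, 3×3, 4×4 and N ≤ 4 of 6×6 (d = 2), of
2×2×2, N ≤ 4 of 3×3×3 and N ≤ 3 of 4×4×4 (d = 3), tabulating B_L(N,Δ) = ‖S⁻_totψ‖² (must be
non-decreasing in Δ and equal N(L^d−N+1) at Δ = 1) and
the nn transverse correlation (expected NON-monotone, audit-12). Script written and ready in this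
seat's folder (kit/xxz_monotone.py, numpy/scipy,
< 1 GB, ≈ 30 min); NOT run: the compute socket was absent at filing (kit: computed socket absent) —
refuters please submit it first. Second check:
the sign of L³(E_L(2) − 2E_L(1) + E_L(0)) at L = 6…10, Δ ∈ {0, 0.5, 0.9, 0.99} (same script family;
must stay positive and → 0 as Δ → 1).

NUMBERS. Exact: B_L(N,1) = N(L^d − N + 1) (= Toth1991's upper bound λ_max ≤ N(V−N+1)/V, saturated
only at the SU(2) point); single magnon ω_k = d·Δ − Σ_i cos k_i
(effective mass 1, hopping ½), two adjacent magnons attract by Δ, so a(Δ) = scattering length of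
hard core + nn well Δ, a(1) = 0 (Dyson1956), a(0) =
hard-core lattice value (simple cubic, via the Watson integral W ≈ 0.5055); KLS anchor constant at d
= 3 (LSSY2005 (11.26), λ = 0, β → ∞):
L^(−2d)A ≥ ½ − ½(√3·W)^(1/2) ≈ 0.032, so the transported Target constant is c ≈ 0.03 (spin-wave/QMC
≈ 0.2); spin-wave depletion per mode
¼[(r_k)^(1/2) + (r_k)^(−1/2) − 2], r_k = (1 − Δγ_k)/(1 − γ_k), is mode-wise DECREASING in Δ on [0,1]
(consistency of AnisotropyMonotone); dA/dΔ = 0 at Δ = 1 at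
every finite L (A's top eigenvector is the Δ = 1 ground state). Items at open: 10 (1 target, 4
cruxes, 4 support, 1 assembly).

DEFINITION REQUESTS. None. The sector ground state is encoded by the penalty over existing
`xxzHamiltonian`, `torusGraph`, `totalSpin`, `Matrix.groundStateFunctional`,
`Matrix.groundSpace`, `lowestEnergyInSector`; the continuum tail uses `PeriodicTrialState`,
`periodicEnergy`, `periodicGroundStateEnergy`,
`condensateOccupation`, `HasGroundStateBEC` (all rc 0 in Sketch.lean). Bib entries added: Dyson1956
(others — CorreggiGiulianiSeiringer2015,
MatsubaraMatsuda1956, ZvyaginTsukernik1985, Heims1964, BalabanEtAl2010 — fetched by `lit cite`,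
`ledger bib add` to be retried: gate socket dropped
mid-batch). WANTED (cite-only, acq-01928): doi:10.1007/bf01017870 ZvyaginTsukernik1985.

Novelty: Searches (2026-08-15, this seat; engines partly rate-limited — OpenAlex 429 daily budget, arXiv 429,
S2 429 intermittently, searchd rc 75 twice):
`lit search "easy-plane XXZ ferromagnet ground state long-range order" --source all` (29 merged: s2
15 + crossref 15; relevant: doi:10.1007/bf01017870
ZvyaginTsukernik1985 JSP 38:405 "The quantum ground state of a Heisenberg ferromagnet with an
easy-plane type anisotropy" (7 pp., paywalled, cite-only
want acq-01928 — title-level nearest, Kharkov school, no LRO theorem on ℤ³ indicated by any citing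
record, cited_by ≤ 1), doi:10.1143/jpsj.58.1027
Nishimori–Ozeki 1989 (2-D XXZ, RP side), doi:10.1016/j.physleta.2007.06.065 Skrypnik 2007 (XXZ-type
models with Gibbsian ground states — the
Rokhsar–Kivelson/parent-Hamiltonian class of the SU(2)-point remark), doi:10.1103/physrevlett.13.50
Heims1964 + PRL 14:850 (1965) comment); `lit search
--source zbmath` "quantum ground state Heisenberg ferromagnet easy-plane anisotropy" (0) and
"Tsukernik ferromagnet ground state anisotropy" (0);
`lit search --source crossref "Zvyagin Tsukernik"` (15; confirms the JSP item, rest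
parametric-excitation physics); `lit search --source crossref` "correlation inequalities quantum XY
model" (12: BenassiLeesUeltschi2016 = doi:10.1007/s10955-016-1580-2 and
doi:10.1007/978-3-319-58904-6_2, nothing sector-restricted), "monotonicity correlations anisotropy
parameter XXZ chain inequality ferromagnetic" (12: Koma–Nachtergaele gap papers
doi:10.1023/a:1007351803403, do  [refs: 10.1007/bf01017870, 10.1143/jpsj.58.1027, 10.1016/j.physleta.2007.06.065, 10.1103/physrevlett.13.50, 10.1007/s10955-016-1580-2, 10.1007/978-3-319-58904-6_2, 10.1023/a:1007351803403, 10.4310/atmp.2001.v5.n6.a3, 10.1088/2399-6528/aae551, 10.1007/bf01042599, 10.1051/jp1:1991109, 1510.03215, doi:10.1007/bf01017870, doi:10.1143/jpsj.58.1027, doi:10.1016/j.physleta.2007.06.065, doi:10.1103/physrevlett.1]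

Barriers (technique_class: anchor-deformation, sector-comparison, infrared-RG): - technique_class: anchor-deformation, sector-comparison, infrared-RG
- Literature.Barriers.AtomisticToContinuum.HalfFillingReflectionPositivity: used ONLY as the Δ = 0
anchor (KLS, a theorem of the tree, inside its scope_caveats); the interval (0,1] has ferromagnetic
z-coupling, where RP of the state fails by sign parity (Speer1985) — AnisotropyMonotone is a
comparison between positive sector ground states invoking no reflection, NearIsotropicPersistence an
expansion from the SU(2) end; honest: no tool for either exists yet, the bets are Perron–Frobenius
positivity + diagonal V, and bounded-deformation RG.
- Literature.Barriers.AtomisticToContinuum.HalfFillingReflectionPositivityNarrow: its proved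
conjunct `rp_oddCharge_eq_zero` (RP state ⇒ ⟨N⟩ = |Λ|/2) is respected — sectors are reached through
SectorMixtureBound (order, not RP) exactly as in BECFillingMonotone; evasion (ii) of the entry
(KuboKishi1988, repulsive Δ ≤ 0) is the OTHER side of Δ = 0 and is not claimed.
- Literature.Barriers.AtomisticToContinuum.BogoliubovPerturbationInfrared: APPLIES SQUARELY to
NearIsotropicPersistence and MethodTransfer (said in their why-lines): d = 3, T = 0, quadratic
dispersion, Σ_k k⁻⁴; it does not evade it — the bet is that the bounded deformation of an exact
gapless multiplet with explicit magnon eigenbasis and lattice UV is where the Ward-identity /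
Feshbach–Schur RG is completed first. AnisotropyMonotone and the Target glue are not expansions and
are untouched.
- Literature.Barriers.

History (route lifecycle, newest last):
- 2026-08-15T13:41:06Z · CLOSED retired — not-a-thesis: assembly does not conclude the sub-problem Statement (operator:999:1257524)

sub-problem: BoseEinsteinCondensation · status: closed(retired) · opened planner-plancard-AtomisticToContinuum-BoseEin-dc2491fc-0 2026-08-15T12:18:49Z · rev 1 · ledger route-AtomisticToContinuum-BECZeroCrossingAnchor
GENERATED by the gate from the ledger (D-0016/17). Provers cite these decls: `theorem foo : Summit.AtomisticToContinuum.BoseEinsteinCondensation.Theses.BECZeroCrossingAnchor.<Decl> := …` in Summits/AtomisticToContinuum/BoseEinsteinCondensation/Theorems/<Name>.lean.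
-/

namespace Summit.AtomisticToContinuum.BoseEinsteinCondensation.Theses.BECZeroCrossingAnchor

open scoped BigOperators Topology Manifold Classical MeasureTheory ProbabilityTheory Matrix InnerProductSpace ComplexConjugate ContinuousMap
open Filter Set Function TopologicalSpace MeasureTheory

attribute [summit_statement] _root_.BoseEinsteinCondensation

/-- item stmt-AtomisticToContinuum-7808 · target · rank 0 · closed · moot by None · by planner
why it might fail: as far as searched it is OPEN for every Δ ∈ (0,1) (no RP: Speer parity); false only if nn attraction below the Heisenberg point destroys the XY condensate at every non-trivial filling on large tori — no mechanism known (spin-wave theory, a(Δ) > 0).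
sources: KLS1988PRL, KuboKishi1988, Speer1985, LSSY2005 Ch. 11 §11.1, BjornbergUeltschi2022, ZvyaginTsukernik1985
[target] the lattice headline (card G4 widened to the whole interval and all d ≥ 2): for every d ≥ 2
there are c > 0 and L₀ such that for every even L ≥ L₀ and EVERY Δ ∈ [0,1] some sector N ≤ L^d/2 of
the XXZ_Δ ferromagnet on (ℤ/Lℤ)^d has ⟨S⁺_tot S⁻_tot⟩ = A_L(N,Δ) + N − L^d/2 ≥ c·L^(2d) (planar
long-range order = BEC of the hard-core gas with nn attraction Δ; by B ≤ N(L^d−N+1) the sector has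
filling ≥ c). Reached from AnisotropyMonotone + SectorMixtureBound + KLS (glue, later) and, for Δ ∈
[1−ε,1], from NearIsotropicPersistence. -/
@[route_item "route-AtomisticToContinuum-BECZeroCrossingAnchor"]
def EasyPlaneIntervalLRO : Prop :=
  ∀ d : ℕ, 2 ≤ d → ∃ c : ℝ, 0 < c ∧ ∃ L₀ : ℕ, ∀ (L : ℕ) [NeZero L], L₀ ≤ L → Even L → ∀ Δ : ℝ, 0 ≤ Δ → Δ ≤ 1 → ∃ N : ℕ, 2 * N ≤ L ^ d ∧ c * ((L : ℝ) ^ d) ^ 2 ≤ ((Literature.MathematicalPhysics.QuantumLattice.xxzHamiltonian 1 (Literature.Probability.LatticeModels.torusGraph d L) (-1) Δ + (((d + 1) * L ^ d : ℕ) : ℂ) • (Literature.MathematicalPhysics.QuantumLattice.totalSpin 1 2 + ((L : ℂ) ^ d / 2 - (N : ℂ)) • 1) ^ 2).groundStateFunctional (Literature.MathematicalPhysics.QuantumLattice.totalSpin 1 0 * Literature.MathematicalPhysics.QuantumLattice.totalSpin 1 0 + Literature.MathematicalPhysics.QuantumLattice.totalSpin 1 1 * Literature.MathematicalPhysics.QuantumLattice.totalSpin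 1 1)).re + N - (L : ℝ) ^ d / 2

/-- item stmt-AtomisticToContinuum-7809 · crux · rank 2 · closed · moot by None · by planner
why it might fail: no sector-restricted Griffiths/Ginibre inequality exists and the zero-field thermal tendency is opposite (BenassiLeesUeltschi2016); the pointwise nn form is false (audit-12); ONE small torus (any d, L, N) with A decreasing somewhere on [0,1] kills it — ED not yet run (compute socket down at filing).
sources: BenassiLeesUeltschi2016, KLS1988PRL, Toth1991, Tasaki2020 §2.5, LSSY2005 Ch. 11 §11.1
[crux] (card G2, REPAIRED per audit-12 to the summed moment) for all d ≥ 1, L ≥ 2, every sector N ≤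
L^d and 0 ≤ Δ ≤ Δ' ≤ 1: A_L(N,Δ) ≤ A_L(N,Δ') — raising the ferromagnetic z-coupling (lowering the
magnon scattering length) never lowers the planar moment of the sector ground state; at Δ' = 1 it is
automatic (A_L(N,1) is the maximum of S¹_tot²+S²_tot² on the sector) and dA/dΔ = 0 there.
[difficulty: L] -/
@[route_item "route-AtomisticToContinuum-BECZeroCrossingAnchor"]
def AnisotropyMonotone : Prop :=
  ∀ (d L : ℕ) [NeZero L], 1 ≤ d → 2 ≤ L → ∀ N : ℕ, N ≤ L ^ d → let A : ℝ → ℝ := (fun t => ((Literature.MathematicalPhysics.QuantumLattice.xxzHamiltonian 1 (Literature.Probability.LatticeModels.torusGraph d L) (-1) t + (((d + 1) * L ^ d : ℕ) : ℂ) • (Literature.MathematicalPhysics.QuantumLattice.totalSpin 1 2 + ((L : ℂ) ^ d / 2 - (N : ℂ)) • 1) ^ 2).groundStateFunctional (Literature.MathematicalPhysics.QuantumLattice.totalSpin 1 0 * Literature.MathematicalPhysics.QuantumLattice.totalSpin 1 0 + Literature.MathematicalPhysics.QuantumLattice.totalSpin 1 1 * Literature.MathematicalPhysics.QuantumLattice.totalSpin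 1 1)).re); ∀ Δ Δ' : ℝ, 0 ≤ Δ → Δ ≤ Δ' → Δ' ≤ 1 → A Δ ≤ A Δ'

/-- item stmt-AtomisticToContinuum-7810 · crux · rank 3 · closed · moot by None · by planner
why it might fail: it IS the marginal d = 3, T = 0 infrared problem (BogoliubovPerturbationInfrared): second order in (1−Δ) gives Σ_k k⁻⁴ ∼ L; no ordered continuous-symmetry Bose phase has ever been constructed (BFKT incomplete, n! bounds in Benfatto's scheme); uniformity in N near ν = ½ is the hardest corner.
sources: Benfatto1994, BalabanEtAl2010, CorreggiGiulianiSeiringer2015, Dyson1956, Heims1964, Literature.Barriers.AtomisticToContinuum.BogoliubovPerturbationInfrared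
[crux] (card G3) for every d ≥ 3 there is ε > 0 such that for all L ≥ 2, all N ≤ L^d and all Δ ∈
[1−ε, 1]: 2·B_L(N,Δ) ≥ N(L^d − N + 1) — at least half of the exact SU(2) value N(L^d−N+1) = B_L(N,1)
survives the bounded easy-plane deformation (1−Δ)·Σ S³S³, UNIFORMLY in volume and filling (small
parameter Y = ν(c₃(1−Δ))³). [difficulty: open-problem] -/
@[route_item "route-AtomisticToContinuum-BECZeroCrossingAnchor"]
def NearIsotropicPersistence : Prop :=
  ∀ d : ℕ, 3 ≤ d → ∃ ε : ℝ, 0 < ε ∧ ∀ (L : ℕ) [NeZero L], 2 ≤ L → ∀ N : ℕ, N ≤ L ^ d → ∀ Δ : ℝ, 1 - ε ≤ Δ → Δ ≤ 1 → (N : ℝ) * ((L : ℝ) ^ d - N + 1) ≤ 2 * (((Literature.MathematicalPhysics.QuantumLattice.xxzHamiltonian 1 (Literature.Probability.LatticeModels.torusGraph d L) (-1) Δ + (((d + 1) * L ^ d : ℕ) : ℂ) • (Literature.MathematicalPhysics.QuantumLattice.totalSpin 1 2 + ((L : ℂ) ^ d / 2 - (N : ℂ)) • 1) ^ 2).groundStateFunctional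 (Literature.MathematicalPhysics.QuantumLattice.totalSpin 1 0 * Literature.MathematicalPhysics.QuantumLattice.totalSpin 1 0 + Literature.MathematicalPhysics.QuantumLattice.totalSpin 1 1 * Literature.MathematicalPhysics.QuantumLattice.totalSpin 1 1)).re + N - (L : ℝ) ^ d / 2)

/-- item stmt-AtomisticToContinuum-7811 · crux · rank 4 · closed · moot by None · by planner
why it might fail: bare implication, no easier than PeriodicBEC unless the antecedent is proved by a transferable scheme: the continuum has no symmetry-protected a = 0 point at fixed admissible v (its twin, Neumann-contact hard spheres, is a boundary condition), and hard cores v = ⊤ make the deformation unbounded.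
sources: LSSY2005 Ch. 5 (5.2), Fournais2020, MatsubaraMatsuda1956, Benfatto1994, Literature.Barriers.AtomisticToContinuum.BogoliubovPerturbationInfrared
[crux] (card G5, the continuum re-run) NearIsotropicPersistence at d = 3 implies PeriodicBEC: for
every repulsive finite-range radial v, small ρ and all large N, every δ-near-minimiser of the
periodic N-body energy on the torus of side (N/ρ)^(1/3) has constant-mode occupation ≥ cN (route
BECPeriodicReduction's rank-2 item stmt-0826, verbatim as consequent). Intended mechanism: the
scheme proving the antecedent (bounded deformation of an exactly condensed gapless point, small
parameter Y) re-run with Y = ρa³ after a Dyson-lemma softening of v; only the scheme transfers, not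
the anchor. [deps: NearIsotropicPersistence] [difficulty: open-problem] -/
@[route_item "route-AtomisticToContinuum-BECZeroCrossingAnchor"]
def MethodTransfer : Prop :=
  (∃ ε : ℝ, 0 < ε ∧ ∀ (L : ℕ) [NeZero L], 2 ≤ L → ∀ N : ℕ, N ≤ L ^ 3 → ∀ Δ : ℝ, 1 - ε ≤ Δ → Δ ≤ 1 → (N : ℝ) * ((L : ℝ) ^ 3 - N + 1) ≤ 2 * (((Literature.MathematicalPhysics.QuantumLattice.xxzHamiltonian 1 (Literature.Probability.LatticeModels.torusGraph 3 L) (-1) Δ + (((3 + 1) * L ^ 3 : ℕ) : ℂ) • (Literature.MathematicalPhysics.QuantumLattice.totalSpin 1 2 + ((L : ℂ) ^ 3 / 2 - (N : ℂ)) • 1) ^ 2).groundStateFunctional (Literature.MathematicalPhysics.QuantumLattice.totalSpin 1 0 * Literature.MathematicalPhysics.QuantumLattice.totalSpin 1 0 + Literature.MathematicalPhysics.QuantumLattice.totalSpin 1 1 * Literature.MathematicalPhysics.QuantumLattice.totalSpin 1 1)).re + N - (L : ℝ) ^ 3 / 2)) → ∀ v : ℝ → ENNReal, Literature.MathematicalPhysics.QuantumManyBody.BoseGas.IsRepulsiveFiniteRange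 v → ∃ ρ₀ : ℝ, 0 < ρ₀ ∧ ∀ ρ : ℝ, 0 < ρ → ρ < ρ₀ → ∃ c : ℝ, 0 < c ∧ ∀ᶠ N : ℕ in Filter.atTop, ∃ δ : ENNReal, 0 < δ ∧ ∀ Ψ : Literature.MathematicalPhysics.QuantumManyBody.BoseGas.PeriodicTrialState N (Literature.MathematicalPhysics.QuantumManyBody.BoseGas.sideLength ρ N), Literature.MathematicalPhysics.QuantumManyBody.BoseGas.periodicEnergy v Ψ ≤ Literature.MathematicalPhysics.QuantumManyBody.BoseGas.periodicGroundStateEnergy v N (Literature.MathematicalPhysics.QuantumManyBody.BoseGas.sideLength ρ N) + δ → ENNReal.ofReal (c * N) ≤ Literature.MathematicalPhysics.QuantumManyBody.BoseGas.condensateOccupation N (Literature.MathematicalPhysics.QuantumManyBody.BoseGas.sideLength ρ N) Ψ.ψ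

/-- item stmt-AtomisticToContinuum-0827 · crux · rank 5 · open · by planner
why it might fail: PeriodicBEC(v) is ground-state-only at the box (N/ρ)^(1/3): the Dirichlet ground state is a periodic trial state but lies a wall term ≫ δ above E₀^per, and interior restrictions are neither periodic nor of sharp N; BEC is boundary-condition sensitive (Robinson1976).
sources: LSSY2005 Ch. 2 after (2.8), Robinson1976, LauwersVerbeureZagrebnov2003, Junge2026, BoccatoSeiringer2023
[crux] BoundaryTransferWeak (mode-free boundary-condition transfer, per potential): for each
repulsive finite-range v, PeriodicBEC(v) implies ∃ρ₀>0 ∀ρ∈(0,ρ₀) HasGroundStateBEC v ρ (Dirichlet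
ground state, λ_max(γ) ≥ cN via condensateNumber). Not glue: near-minimiser slacks are O(N/L²) while
Dirichlet/periodic energies differ by a boundary term ≫ N/L², so no energy-comparison proof;
expected route: Neumann bracketing of interior sub-boxes (−Δ_Dir ≥ ⊕−Δ_Neu, v ≥ 0) + a mode-free
criterion (λ_max ≥ tr γ²/N). Only the ENERGY analogue is in print (LiebSeiringerSolovejYngvason2005
Ch. 2 after (2.8)). v ≡ 0: hypothesis and conclusion both true. -/
@[route_item "route-AtomisticToContinuum-BECZeroCrossingAnchor"]
def BoundaryTransferWeak : Prop :=
  ∀ v : ℝ → ENNReal, Literature.MathematicalPhysics.QuantumManyBody.BoseGas.IsRepulsiveFiniteRange v → (∃ ρ₀ : ℝ, 0 < ρ₀ ∧ ∀ ρ : ℝ, 0 < ρ → ρ < ρ₀ → ∃ c : ℝ, 0 < c ∧ ∀ᶠ N : ℕ in Filter.atTop, ∃ δ : ENNReal, 0 < δ ∧ ∀ Ψ : Literature.MathematicalPhysics.QuantumManyBody.BoseGas.PeriodicTrialState N (Literature.MathematicalPhysics.QuantumManyBody.BoseGas.sideLength ρ N), Literature.MathematicalPhysics.QuantumManyBody.BoseGas.periodicEnergy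 v Ψ ≤ Literature.MathematicalPhysics.QuantumManyBody.BoseGas.periodicGroundStateEnergy v N (Literature.MathematicalPhysics.QuantumManyBody.BoseGas.sideLength ρ N) + δ → ENNReal.ofReal (c * N) ≤ Literature.MathematicalPhysics.QuantumManyBody.BoseGas.condensateOccupation N (Literature.MathematicalPhysics.QuantumManyBody.BoseGas.sideLength ρ N) Ψ.ψ) → ∃ ρ₀ : ℝ, 0 < ρ₀ ∧ ∀ ρ : ℝ, 0 < ρ → ρ < ρ₀ → Literature.MathematicalPhysics.QuantumManyBody.BoseGas.HasGroundStateBEC v ρ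

/-- item stmt-AtomisticToContinuum-5009 · support · rank 9 · closed · moot by None · by planner
sources: KLS1988PRL, Tasaki2020 §2.1–2.2
[support] for d ≥ 1 and even L, the all-sector (tracial) KLS planar moment Σ_{x,y}
groundStateXYCorrTorus L 1 x y is at most A_L(N) for some sector with 2N ≤ L^d: the global ground
projector of `xyTorus d L 1` is block-diagonal in S³_tot, each occupied block is the ground space of
the penalised Hamiltonian, the tracial state is a convex combination of sector states, and the spin
flip (π-rotation about S¹) identifies A_L(N) = A_L(L^d − N). [difficulty: provable-now] -/
@[route_item "route-AtomisticToContinuum-BECZeroCrossingAnchor"]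
def SectorMixtureBound : Prop :=
  ∀ (d L : ℕ) [NeZero L], 1 ≤ d → Even L → ∃ N : ℕ, 2 * N ≤ L ^ d ∧ ∑ x : Literature.Probability.LatticeModels.TorusSite d L, ∑ y : Literature.Probability.LatticeModels.TorusSite d L, Literature.MathematicalPhysics.QuantumLattice.groundStateXYCorrTorus L 1 x y ≤ ((Literature.MathematicalPhysics.QuantumLattice.xyTorus d L 1 + (((d + 1) * L ^ d : ℕ) : ℂ) • (Literature.MathematicalPhysics.QuantumLattice.totalSpin 1 2 + ((L : ℂ) ^ d / 2 - (N : ℂ)) • 1) ^ 2).groundStateFunctional (Literature.MathematicalPhysics.QuantumLattice.totalSpin 1 0 * Literature.MathematicalPhysics.QuantumLattice.totalSpin 1 0 + Literature.MathematicalPhysics.QuantumLattice.totalSpin 1 1 * Literature.MathematicalPhysics.QuantumLattice.totalSpin 1 1)).re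

/-- item stmt-AtomisticToContinuum-7812 · support · rank 9 · closed · moot by None · by planner
sources: Tasaki2020 §2.5, Toth1991, Heims1964
[support] (card G1(i), the SU(2) end) for d ≥ 1, L ≥ 2 and every N ≤ L^d: A_L(N,1) + N − L^d/2 =
N(L^d − N + 1) — at Δ = 1, H_1 + (number of edges)/4 = ½Σ_⟨xy⟩(1 − T_xy) (T = transposition), so on
the connected torus the sector ground space is the one symmetric vector |S = L^d/2, M = N − L^d/2⟩
(penalty selects the sector), and ⟨S⁺_tot S⁻_tot⟩ = S(S+1) − M² + M. [difficulty: provable-now] -/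
@[route_item "route-AtomisticToContinuum-BECZeroCrossingAnchor"]
def AnchorExact : Prop :=
  ∀ (d L : ℕ) [NeZero L], 1 ≤ d → 2 ≤ L → ∀ N : ℕ, N ≤ L ^ d → ((Literature.MathematicalPhysics.QuantumLattice.xxzHamiltonian 1 (Literature.Probability.LatticeModels.torusGraph d L) (-1) 1 + (((d + 1) * L ^ d : ℕ) : ℂ) • (Literature.MathematicalPhysics.QuantumLattice.totalSpin 1 2 + ((L : ℂ) ^ d / 2 - (N : ℂ)) • 1) ^ 2).groundStateFunctional (Literature.MathematicalPhysics.QuantumLattice.totalSpin 1 0 * Literature.MathematicalPhysics.QuantumLattice.totalSpin 1 0 + Literature.MathematicalPhysics.QuantumLattice.totalSpin 1 1 * Literature.MathematicalPhysics.QuantumLattice.totalSpin 1 1)).re + N - (L : ℝ) ^ d / 2 = (N : ℝ) * ((L : ℝ) ^ d - N + 1)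

/-- item stmt-AtomisticToContinuum-7813 · support · rank 9 · closed · moot by None · by planner
sources: Tasaki2020 §2.1, KLS1988PRL
[support] (encoding lemma, XXZ version of BECFillingMonotone's PenaltySelectsSector) for d ≥ 1, N ≤
L^d and 0 ≤ Δ ≤ 1, every ground vector of H_Δ + (d+1)L^d·(S³_tot + (L^d/2 − N)·1)² lies in the
sector S³_tot = N − L^d/2: each bond −(S¹S¹ + S²S² + ΔS³S³) has spectral width exactly 1 for |Δ| ≤
1, so the width of H_Δ is ≤ (number of edges) ≤ d·L^d < (d+1)L^d, and the sector is non-empty.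
[difficulty: provable-now] -/
@[route_item "route-AtomisticToContinuum-BECZeroCrossingAnchor"]
def PenaltySelectsSectorXXZ : Prop :=
  ∀ (d L : ℕ) [NeZero L] (N : ℕ), 1 ≤ d → N ≤ L ^ d → ∀ Δ : ℝ, 0 ≤ Δ → Δ ≤ 1 → ∀ ψ : Literature.MathematicalPhysics.QuantumLattice.TensorIndex (Literature.Probability.LatticeModels.TorusSite d L) 2 → ℂ, ψ ∈ (Literature.MathematicalPhysics.QuantumLattice.xxzHamiltonian 1 (Literature.Probability.LatticeModels.torusGraph d L) (-1) Δ + (((d + 1) * L ^ d : ℕ) : ℂ) • (Literature.MathematicalPhysics.QuantumLattice.totalSpin 1 2 + ((L : ℂ) ^ d / 2 - (N : ℂ)) • 1) ^ 2).groundSpace → (Literature.MathematicalPhysics.QuantumLattice.totalSpin (Λ := Literature.Probability.LatticeModels.TorusSite d L) 1 2 + ((L : ℂ) ^ d / 2 - (N : ℂ)) • 1).mulVec ψ = 0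

/-- item stmt-AtomisticToContinuum-7814 · support · rank 9 · closed · moot by None · by planner
sources: Dyson1956, doi:10.1103/PhysRev.132.85, LSSY2005 App. A, Tasaki2020 §2.5
[support] (card G1(ii), the sign the dictionary rests on; d = 3) for every Δ ∈ [0,1) the two-magnon
finite-volume energy shift is eventually positive at the scattering-length scale: liminf_L
L³·(E_L(2) − 2E_L(1) + E_L(0)) > 0, E_L(k) = lowest energy of H_Δ on (ℤ/Lℤ)³ in the sector S³_tot =
k − L³/2 (Huang–Yang/Lüscher: the limit is 8π·a(Δ) with a(Δ) > 0 the s-wave scattering length of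
hard core + nn attraction Δ, decreasing to a(1) = 0; at Δ = 1 the shift vanishes identically by
SU(2)). [difficulty: M] -/
@[route_item "route-AtomisticToContinuum-BECZeroCrossingAnchor"]
def ScatteringLengthSign : Prop :=
  ∀ Δ : ℝ, 0 ≤ Δ → Δ < 1 → 0 < Filter.liminf (fun n : ℕ => ((n + 1 : ℕ) : ℝ) ^ 3 * (Literature.MathematicalPhysics.QuantumLattice.lowestEnergyInSector 1 (Literature.MathematicalPhysics.QuantumLattice.xxzHamiltonian 1 (Literature.Probability.LatticeModels.torusGraph 3 (n + 1)) (-1) Δ) ((2 : ℝ) - ((n + 1 : ℕ) : ℝ) ^ 3 / 2) - 2 * Literature.MathematicalPhysics.QuantumLattice.lowestEnergyInSector 1 (Literature.MathematicalPhysics.QuantumLattice.xxzHamiltonian 1 (Literature.Probability.LatticeModels.torusGraph 3 (n + 1)) (-1) Δ) ((1 : ℝ) - ((n + 1 : ℕ) : ℝ) ^ 3 / 2) + Literature.MathematicalPhysics.QuantumLattice.lowestEnergyInSector 1 (Literature.MathematicalPhysics.QuantumLattice.xxzHamiltonian 1 (Literature.Probability.LatticeModels.torusGraph 3 (n + 1))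 (-1) Δ) ((0 : ℝ) - ((n + 1 : ℕ) : ℝ) ^ 3 / 2))) Filter.atTop

/-- item stmt-AtomisticToContinuum-7815 · assembly · rank 1 · closed · moot by None · by planner
sources: LSSY2005 §1.2 and Ch. 5, KLS1988PRL
[assembly] NearIsotropicPersistence → MethodTransfer → BoundaryTransferWeak →
BoseEinsteinCondensation. -/
@[route_item "route-AtomisticToContinuum-BECZeroCrossingAnchor"]
def Assembly : Prop :=
  NearIsotropicPersistence → MethodTransfer → BoundaryTransferWeak → Literature.MathematicalPhysics.QuantumManyBody.BoseGas.BoseEinsteinCondensation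

end Summit.AtomisticToContinuum.BoseEinsteinCondensation.Theses.BECZeroCrossingAnchor
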